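import Summits.QuantumFields.YangMills.Theorems.BalabanLadderUVSeamRecCeilingsPolymerRarity
import Mathlib.MeasureTheory.Integral.MeanInequalities
import HarnessLib

/-!
# Crux `UVSeamRec` (stmt-QuantumFields-20043), v5(α) stub `stub_responseMomentsOdd6` (RM): LEVELWISE composition —
# the joint exponential moments of a MULTISCALE influence functional from PER-LEVEL polymer laws alone, by a
# generalised Hölder inequality across levels with scale-weighted exponents

Helper file (`--supports stmt-QuantumFields-20043`) of the width-lever seat `ym-20043-ceilings-p2` (lane B, gen 3); sequel of p527372
`…CeilingsPolymerRarity.lean` (`integral_exp_sum_indicator_le_exp`: the ideal-gas domination of a polymer gas with a product law).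
THE POINT.  The large-field carrier of the (β) architecture of (RM) is a sum over LEVELS `k ≤ kmax` of linear influence functionals
`I_{k,i} = Σ_{γ level k} a_{iγ} 1_{E_γ}`, and the product law (PL) was so far asked JOINTLY over all levels (p535725, p543486, this seat's
`…ResponseCarriersPeriodic`).  A joint law across NESTED scales with the natural weights is NOT a consequence of per-level laws (block fields at
nested scales are positively correlated), whereas per-level laws are the natural output of a scale-by-scale analysis (and level `0` is the
tree's p530009).  This file shows that PER-LEVEL laws suffice, with NO loss in the constants, because the per-polymer coefficient totals
`Λ_k = sup_γ Σ_i a_{iγ}` are summable over the levels (for tempered-d1's coefficients `(b^k/dist)⁴` on the shells: `Λ_k ≤ 16(b^k/(R+2+2b^k))⁴`,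
`Σ_k Λ_k ≤ 1`, see the sequel `…ResponseCarriersLevelwise`): Hölder across levels with exponents `p_k = (Σ_j Λ_j)/Λ_k` costs the factor
`e^{λ p_k Λ_k} = e^{λ Σ_j Λ_j}` per level — the SAME factor as the joint law's `e^{λΛ}` — and the per-cube density budgets ADD over the levels.

* §1 `integral_exp_sum_le_exp_sum_of_holder` — generalised Hölder for exponential moments on a probability space: if `Σ_k 1/p_k = 1` and
  `∫ exp(p_k F_k) ≤ exp(p_k C_k)` for every level, then `∫ exp(Σ_k F_k) ≤ exp(Σ_k C_k)` (Mathlib's `ENNReal.lintegral_prod_norm_pow_le`).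
* §2 `integral_exp_mul_sum_influence_le_sum` — p527372's single-system bound with the per-cube budgets SUMMED rather than bounded uniformly:
  `∫ exp(λ Σ_{i∈T} I_i) ≤ exp(λ e^{λΛ} Σ_{i∈T} Σ_γ a_{iγ} w_γ)`.
* §3 `integral_exp_mul_sum_levels_le` — THE LEVELWISE THEOREM: per-level polymer systems `(S_k, E, w, a)` with per-level product laws,
  coefficient totals `Σ_{i∈T} a_{iγ} ≤ Λ_k` on `S_k`, `0 < Λ_k`, `Σ_{k} Λ_k ≤ Λ`: `∫ exp(λ Σ_{i∈T} Σ_k I_{k,i}) ≤ exp(λ e^{λΛ} Σ_{i∈T} Σ_k Σ_{γ∈S_k} a_{iγ} w_γ)`;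
  `integral_exp_mul_sum_levels_le_card` — with a uniform TOTAL budget `Σ_k Σ_{γ∈S_k} a_{iγ} w_γ ≤ W`: `≤ exp(λ e^{λΛ} W · #T)`, the exact
  shape of p527372's `integral_exp_mul_sum_influence_le`.

HONEST FRAMING: abstract probability bookkeeping for the OPEN block-level product laws of the (β) architecture; nothing of E0′; not a gap, not Clay.
References: folklore (generalised Hölder inequality; ideal-gas domination as in R. Kotecký, D. Preiss, Commun. Math. Phys. 103 (1986) 491–498).
-/

set_option autoImplicit false

noncomputable section

open MeasureTheory Finset
open scoped ENNReal
open Literature.MathematicalPhysics.QuantumLattice (integrable_of_abs_le)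

namespace Summit.QuantumFields.YangMills.Cruxes.UVSeamRec.PolymerRarity

variable {Ω : Type*} [MeasurableSpace Ω] (μ : Measure Ω) [IsProbabilityMeasure μ]

/-! ## §1 Generalised Hölder for exponential moments -/

section Holder

/-- **Generalised Hölder inequality for exponential moments.**  On a probability space, for finitely many bounded measurable `F_k` and
exponents `p_k > 0` with `Σ_k 1/p_k = 1`: if `∫ exp(p_k F_k) dμ ≤ exp(p_k C_k)` for every `k`, then `∫ exp(Σ_k F_k) dμ ≤ exp(Σ_k C_k)`.
Proof: `∫ ∏_k f_k^{1/p_k} ≤ ∏_k (∫ f_k)^{1/p_k}` (Mathlib's `ENNReal.lintegral_prod_norm_pow_le`) with `f_k = exp(p_k F_k)`. [folklore] -/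
theorem integral_exp_sum_le_exp_sum_of_holder {κ : Type*} (K : Finset κ) (F : κ → Ω → ℝ)
    (hFm : ∀ k ∈ K, Measurable (F k)) (M : κ → ℝ) (hFb : ∀ k ∈ K, ∀ ω, |F k ω| ≤ M k)
    (p C : κ → ℝ) (hp : ∀ k ∈ K, 0 < p k) (hsum : ∑ k ∈ K, 1 / p k = 1)
    (hmom : ∀ k ∈ K, ∫ ω, Real.exp (p k * F k ω) ∂μ ≤ Real.exp (p k * C k)) :
    ∫ ω, Real.exp (∑ k ∈ K, F k ω) ∂μ ≤ Real.exp (∑ k ∈ K, C k) := by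
  -- the functions `f_k = exp(p_k F_k)` read in `ℝ≥0∞`
  set f : κ → Ω → ℝ≥0∞ := fun k ω => ENNReal.ofReal (Real.exp (p k * F k ω)) with hf
  have hfm : ∀ k ∈ K, AEMeasurable (f k) μ := fun k hk =>
    (((hFm k hk).const_mul (p k)).exp.ennreal_ofReal).aemeasurable
  have hH := ENNReal.lintegral_prod_norm_pow_le K hfm hsum (fun k hk => (one_div_pos.2 (hp k hk)).le)
  -- the integrand of the left-hand side is `exp(Σ_k F_k)`
  have hlhs : ∀ ω, ∏ k ∈ K, f k ω ^ (1 / p k) = ENNReal.ofReal (Real.exp (∑ k ∈ K, F k ω)) := by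
    intro ω
    rw [Real.exp_sum, ENNReal.ofReal_prod_of_nonneg (fun k _ => (Real.exp_pos _).le)]
    refine Finset.prod_congr rfl fun k hk => ?_
    rw [hf, ENNReal.ofReal_rpow_of_nonneg (Real.exp_pos _).le (one_div_pos.2 (hp k hk)).le, ← Real.exp_mul]
    congr 2
    field_simp [(hp k hk).ne']
  -- integrability of `exp(Σ_k F_k)` (bounded on a probability space)
  have hsm : Measurable fun ω => ∑ k ∈ K, F k ω := Finset.measurable_sum K fun k hk => hFm k hk
  have hint : Integrable (fun ω => Real.exp (∑ k ∈ K, F k ω)) μ := by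
    refine integrable_of_abs_le hsm.exp (C := Real.exp (∑ k ∈ K, M k)) fun ω => ?_
    rw [Real.abs_exp]
    exact Real.exp_le_exp.2 (Finset.sum_le_sum fun k hk => (le_abs_self _).trans (hFb k hk ω))
  have hL : ∫⁻ ω, ∏ k ∈ K, f k ω ^ (1 / p k) ∂μ = ENNReal.ofReal (∫ ω, Real.exp (∑ k ∈ K, F k ω) ∂μ) := by
    rw [lintegral_congr hlhs, ← ofReal_integral_eq_lintegral_ofReal hint (ae_of_all _ fun ω => (Real.exp_pos _).le)]
  -- each factor of the right-hand side is at most `ofReal (exp C_k)`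
  have hR : ∀ k ∈ K, (∫⁻ ω, f k ω ∂μ) ^ (1 / p k) ≤ ENNReal.ofReal (Real.exp (C k)) := by
    intro k hk
    have hmk : Measurable fun ω => p k * F k ω := (hFm k hk).const_mul (p k)
    have hintk : Integrable (fun ω => Real.exp (p k * F k ω)) μ := by
      refine integrable_of_abs_le hmk.exp (C := Real.exp (|p k| * M k)) fun ω => ?_
      rw [Real.abs_exp]
      refine Real.exp_le_exp.2 ((le_abs_self _).trans ?_)
      rw [abs_mul]
      exact mul_le_mul_of_nonneg_left (hFb k hk ω) (abs_nonneg _)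
    have h1 : ∫⁻ ω, f k ω ∂μ = ENNReal.ofReal (∫ ω, Real.exp (p k * F k ω) ∂μ) := by
      rw [hf, ← ofReal_integral_eq_lintegral_ofReal hintk (ae_of_all _ fun ω => (Real.exp_pos _).le)]
    rw [h1]
    calc ENNReal.ofReal (∫ ω, Real.exp (p k * F k ω) ∂μ) ^ (1 / p k)
        ≤ ENNReal.ofReal (Real.exp (p k * C k)) ^ (1 / p k) :=
          ENNReal.rpow_le_rpow (ENNReal.ofReal_le_ofReal (hmom k hk)) (one_div_pos.2 (hp k hk)).le
      _ = ENNReal.ofReal (Real.exp (C k)) := by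
          rw [ENNReal.ofReal_rpow_of_nonneg (Real.exp_pos _).le (one_div_pos.2 (hp k hk)).le, ← Real.exp_mul]
          congr 2
          field_simp [(hp k hk).ne']
  have hRprod : ∏ k ∈ K, (∫⁻ ω, f k ω ∂μ) ^ (1 / p k) ≤ ENNReal.ofReal (Real.exp (∑ k ∈ K, C k)) := by
    rw [Real.exp_sum, ENNReal.ofReal_prod_of_nonneg (fun k _ => (Real.exp_pos _).le)]
    exact Finset.prod_le_prod' fun k hk => hR k hk
  have hfin := (hL.symm.le.trans hH).trans hRprod
  exact (ENNReal.ofReal_le_ofReal_iff (Real.exp_pos _).le).1 hfin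

end Holder

/-! ## §2 One polymer system: the joint moment bound with SUMMED per-cube budgets -/

section Summed

variable {κ : Type*}

/-- **Ideal-gas bound with summed budgets.**  For a polymer system (events `E_γ` with product law of weights `w_γ ≥ 0`, coefficients
`a_{iγ} ≥ 0` with `Σ_{i∈T} a_{iγ} ≤ Λ`) and `λ ≥ 0`:
`∫ exp(λ Σ_{i∈T} Σ_γ a_{iγ} 1_{E_γ}) dμ ≤ exp(λ e^{λΛ} · Σ_{i∈T} Σ_γ a_{iγ} w_γ)` — p527372's `integral_exp_mul_sum_influence_le` before the
uniform budget bound `Σ_γ a_{iγ} w_γ ≤ W` is applied (so that budgets of several systems can be ADDED cube by cube). [folklore] -/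
theorem integral_exp_mul_sum_influence_le_sum {ι : Type*} (T : Finset ι) (S : Finset κ) (E : κ → Set Ω)
    (hE : ∀ γ, MeasurableSet (E γ)) (w : κ → ℝ) (hw : ∀ γ ∈ S, 0 ≤ w γ)
    (a : ι → κ → ℝ) (ha : ∀ i ∈ T, ∀ γ ∈ S, 0 ≤ a i γ) {lam Λ : ℝ} (hlam : 0 ≤ lam)
    (hΛ : ∀ γ ∈ S, ∑ i ∈ T, a i γ ≤ Λ)
    (hPL : ∀ A, A ⊆ S → μ.real (⋂ γ ∈ A, E γ) ≤ ∏ γ ∈ A, w γ) :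
    ∫ ω, Real.exp (lam * ∑ i ∈ T, ∑ γ ∈ S, a i γ * (E γ).indicator (fun _ => (1 : ℝ)) ω) ∂μ ≤
      Real.exp (lam * Real.exp (lam * Λ) * ∑ i ∈ T, ∑ γ ∈ S, a i γ * w γ) := by
  -- exchange the sums: the joint tilt is a polymer tilt with `t_γ = λ Σ_{i∈T} a_{iγ}`
  have hswap : ∀ ω, lam * ∑ i ∈ T, ∑ γ ∈ S, a i γ * (E γ).indicator (fun _ => (1 : ℝ)) ω =
      ∑ γ ∈ S, (lam * ∑ i ∈ T, a i γ) * (E γ).indicator (fun _ => (1 : ℝ)) ω := by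
    intro ω
    rw [Finset.sum_comm, Finset.mul_sum]
    refine Finset.sum_congr rfl fun γ _ => ?_
    rw [mul_assoc, Finset.sum_mul]
  simp_rw [hswap]
  have ht : ∀ γ ∈ S, 0 ≤ lam * ∑ i ∈ T, a i γ := fun γ hγ =>
    mul_nonneg hlam (Finset.sum_nonneg fun i hi => ha i hi γ hγ)
  refine (integral_exp_sum_indicator_le_exp μ S E hE _ w ht hw hPL).trans (Real.exp_le_exp.2 ?_)
  -- `e^{t} − 1 ≤ t e^{t} ≤ t e^{λΛ}`
  have hexp : ∀ x : ℝ, Real.exp x - 1 ≤ x * Real.exp x := fun x => by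
    have h2 : Real.exp x * (1 - x) ≤ Real.exp x * Real.exp (-x) :=
      mul_le_mul_of_nonneg_left (Real.one_sub_le_exp_neg x) (Real.exp_pos x).le
    rw [← Real.exp_add, add_neg_cancel, Real.exp_zero] at h2
    nlinarith
  have hΛ' : ∀ γ ∈ S, lam * ∑ i ∈ T, a i γ ≤ lam * Λ := fun γ hγ => mul_le_mul_of_nonneg_left (hΛ γ hγ) hlam
  calc ∑ γ ∈ S, (Real.exp (lam * ∑ i ∈ T, a i γ) - 1) * w γ
      ≤ ∑ γ ∈ S, ((lam * ∑ i ∈ T, a i γ) * Real.exp (lam * Λ)) * w γ := by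
        refine Finset.sum_le_sum fun γ hγ => mul_le_mul_of_nonneg_right ?_ (hw γ hγ)
        exact (hexp _).trans
          (mul_le_mul_of_nonneg_left (Real.exp_le_exp.2 (hΛ' γ hγ)) (ht γ hγ))
    _ = ∑ γ ∈ S, lam * Real.exp (lam * Λ) * ∑ i ∈ T, a i γ * w γ := by
        refine Finset.sum_congr rfl fun γ _ => ?_
        rw [← Finset.sum_mul]
        ring
    _ = lam * Real.exp (lam * Λ) * ∑ i ∈ T, ∑ γ ∈ S, a i γ * w γ := by
        rw [← Finset.mul_sum, Finset.sum_comm]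

end Summed

/-! ## §3 The levelwise theorem -/

section Levelwise

variable {κ : Type*}

/-- **JOINT EXPONENTIAL MOMENTS OF A MULTISCALE INFLUENCE FUNCTIONAL FROM PER-LEVEL POLYMER LAWS.**  Levels `k ∈ K` (finite); for each
level a polymer system on a common polymer type: index sets `S k`, measurable events `E γ`, weights `w γ ≥ 0` on `S k`, coefficients
`a i γ ≥ 0`, with the PER-LEVEL product law `μ(⋂_{γ∈A} E_γ) ≤ ∏_{γ∈A} w_γ` for `A ⊆ S k` and the per-level coefficient totals
`Σ_{i∈T} a_{iγ} ≤ Λ_k` (`γ ∈ S k`), `0 < Λ_k`, `Σ_{k∈K} Λ_k ≤ Λ`.  Then for `λ ≥ 0`: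
`∫ exp(λ Σ_{i∈T} Σ_{k∈K} Σ_{γ∈S k} a_{iγ} 1_{E_γ}) dμ ≤ exp(λ e^{λΛ} Σ_{i∈T} Σ_{k∈K} Σ_{γ∈S k} a_{iγ} w_γ)` — the SAME bound the joint (all-levels)
product law would give (p527372), although only per-level laws are assumed.  Proof: Hölder across levels (§1) with exponents
`p_k = (Σ_j Λ_j)/Λ_k`, so that `p_k Λ_k = Σ_j Λ_j ≤ Λ` for every level, and §2 at parameter `λ p_k` for each level. [folklore] -/
theorem integral_exp_mul_sum_levels_le {ι : Type*} {L : Type*} (T : Finset ι) (K : Finset L) (S : L → Finset κ)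
    (E : κ → Set Ω) (hE : ∀ γ, MeasurableSet (E γ)) (w : κ → ℝ) (hw : ∀ k ∈ K, ∀ γ ∈ S k, 0 ≤ w γ)
    (a : ι → κ → ℝ) (ha : ∀ k ∈ K, ∀ i ∈ T, ∀ γ ∈ S k, 0 ≤ a i γ) {lam Λ : ℝ} (hlam : 0 ≤ lam)
    (Λl : L → ℝ) (hΛpos : ∀ k ∈ K, 0 < Λl k) (hΛl : ∀ k ∈ K, ∀ γ ∈ S k, ∑ i ∈ T, a i γ ≤ Λl k)
    (hΛsum : ∑ k ∈ K, Λl k ≤ Λ)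
    (hPL : ∀ k ∈ K, ∀ A, A ⊆ S k → μ.real (⋂ γ ∈ A, E γ) ≤ ∏ γ ∈ A, w γ) :
    ∫ ω, Real.exp (lam * ∑ i ∈ T, ∑ k ∈ K, ∑ γ ∈ S k, a i γ * (E γ).indicator (fun _ => (1 : ℝ)) ω) ∂μ ≤
      Real.exp (lam * Real.exp (lam * Λ) * ∑ i ∈ T, ∑ k ∈ K, ∑ γ ∈ S k, a i γ * w γ) := by
  classical
  -- the per-level functionals `F_k = λ Σ_{i∈T} I_{k,i}` and their budgets
  set F : L → Ω → ℝ := fun k ω => lam * ∑ i ∈ T, ∑ γ ∈ S k, a i γ * (E γ).indicator (fun _ => (1 : ℝ)) ω with hF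
  set Λtot : ℝ := ∑ k ∈ K, Λl k with hΛtot
  -- empty level set: both sides are `exp 0`-trivial
  rcases K.eq_empty_or_nonempty with hK | hK
  · subst hK
    simp
  have hΛtot_pos : 0 < Λtot := Finset.sum_pos (fun k hk => hΛpos k hk) hK
  -- rewrite the integrand as `exp(Σ_k F_k)`
  have hswap : ∀ ω, lam * ∑ i ∈ T, ∑ k ∈ K, ∑ γ ∈ S k, a i γ * (E γ).indicator (fun _ => (1 : ℝ)) ω =
      ∑ k ∈ K, F k ω := by
    intro ω
    simp only [hF]
    rw [← Finset.mul_sum, Finset.sum_comm]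
  simp_rw [hswap]
  -- Hölder data
  set p : L → ℝ := fun k => Λtot / Λl k with hp
  set C : L → ℝ := fun k => lam * Real.exp (lam * Λ) * ∑ i ∈ T, ∑ γ ∈ S k, a i γ * w γ with hC
  have hp_pos : ∀ k ∈ K, 0 < p k := fun k hk => div_pos hΛtot_pos (hΛpos k hk)
  have hpsum : ∑ k ∈ K, 1 / p k = 1 := by
    have : ∀ k ∈ K, 1 / p k = Λl k / Λtot := fun k hk => by
      simp only [hp]
      rw [one_div_div]
    rw [Finset.sum_congr rfl this, ← Finset.sum_div, div_self hΛtot_pos.ne']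
  -- measurability and bounds of the `F_k`
  have hχm : ∀ γ, Measurable fun ω => (E γ).indicator (fun _ => (1 : ℝ)) ω := fun γ =>
    measurable_const.indicator (hE γ)
  have hχb : ∀ γ ω, |(E γ).indicator (fun _ => (1 : ℝ)) ω| ≤ 1 := fun γ ω => by
    rw [abs_of_nonneg (Set.indicator_nonneg (fun _ _ => zero_le_one) _)]
    exact Set.indicator_apply_le' (fun _ => le_rfl) (fun _ => zero_le_one)
  have hFm : ∀ k ∈ K, Measurable (F k) := fun k _ =>
    (Finset.measurable_sum T fun i _ => Finset.measurable_sum (S k) fun γ _ => (hχm γ).const_mul _).const_mul _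
  have hFb : ∀ k ∈ K, ∀ ω, |F k ω| ≤ lam * ∑ i ∈ T, ∑ γ ∈ S k, |a i γ| := by
    intro k _ ω
    simp only [hF]
    rw [abs_mul, abs_of_nonneg hlam]
    refine mul_le_mul_of_nonneg_left ((Finset.abs_sum_le_sum_abs _ _).trans
      (Finset.sum_le_sum fun i _ => (Finset.abs_sum_le_sum_abs _ _).trans
        (Finset.sum_le_sum fun γ _ => ?_))) hlam
    rw [abs_mul]
    calc |a i γ| * |(E γ).indicator (fun _ => (1 : ℝ)) ω| ≤ |a i γ| * 1 :=
          mul_le_mul_of_nonneg_left (hχb γ ω) (abs_nonneg _)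
      _ = |a i γ| := mul_one _
  -- per-level moment bounds at parameter `λ p_k` (§2), using `p_k Λ_k = Λtot ≤ Λ`
  have hmom : ∀ k ∈ K, ∫ ω, Real.exp (p k * F k ω) ∂μ ≤ Real.exp (p k * C k) := by
    intro k hk
    have hpk := hp_pos k hk
    have hpF : ∀ ω, p k * F k ω =
        (p k * lam) * ∑ i ∈ T, ∑ γ ∈ S k, a i γ * (E γ).indicator (fun _ => (1 : ℝ)) ω := by
      intro ω; simp only [hF]; ring
    simp_rw [hpF]
    have h2 := integral_exp_mul_sum_influence_le_sum μ T (S k) E hE w (hw k hk) a (ha k hk)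
      (lam := p k * lam) (Λ := Λl k) (mul_nonneg hpk.le hlam) (hΛl k hk) (hPL k hk)
    refine h2.trans (Real.exp_le_exp.2 ?_)
    have hpΛ : p k * lam * Λl k ≤ lam * Λ := by
      have : p k * Λl k = Λtot := by
        simp only [hp]
        rw [div_mul_cancel₀ _ (hΛpos k hk).ne']
      calc p k * lam * Λl k = lam * (p k * Λl k) := by ring
        _ = lam * Λtot := by rw [this]
        _ ≤ lam * Λ := mul_le_mul_of_nonneg_left hΛsum hlam
    have hB : 0 ≤ ∑ i ∈ T, ∑ γ ∈ S k, a i γ * w γ :=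
      Finset.sum_nonneg fun i hi => Finset.sum_nonneg fun γ hγ => mul_nonneg (ha k hk i hi γ hγ) (hw k hk γ hγ)
    calc p k * lam * Real.exp (p k * lam * Λl k) * ∑ i ∈ T, ∑ γ ∈ S k, a i γ * w γ
        ≤ p k * lam * Real.exp (lam * Λ) * ∑ i ∈ T, ∑ γ ∈ S k, a i γ * w γ := by
          refine mul_le_mul_of_nonneg_right (mul_le_mul_of_nonneg_left (Real.exp_le_exp.2 hpΛ)
            (mul_nonneg hpk.le hlam)) hB
      _ = p k * C k := by simp only [hC]; ring
  -- Hölder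
  have hH := integral_exp_sum_le_exp_sum_of_holder μ K F hFm _ hFb p C hp_pos hpsum hmom
  refine hH.trans (le_of_eq ?_)
  simp only [hC]
  rw [← Finset.mul_sum, Finset.sum_comm]

/-- The levelwise theorem with a uniform TOTAL density budget `Σ_{k∈K} Σ_{γ∈S k} a_{iγ} w_γ ≤ W` for every cube `i ∈ T`:
`∫ exp(λ Σ_{i∈T} Σ_k I_{k,i}) dμ ≤ exp(λ e^{λΛ} W · #T)` — the exact shape of p527372's `integral_exp_mul_sum_influence_le`. [folklore] -/
theorem integral_exp_mul_sum_levels_le_card {ι : Type*} {L : Type*} (T : Finset ι) (K : Finset L) (S : L → Finset κ)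
    (E : κ → Set Ω) (hE : ∀ γ, MeasurableSet (E γ)) (w : κ → ℝ) (hw : ∀ k ∈ K, ∀ γ ∈ S k, 0 ≤ w γ)
    (a : ι → κ → ℝ) (ha : ∀ k ∈ K, ∀ i ∈ T, ∀ γ ∈ S k, 0 ≤ a i γ) {lam Λ W : ℝ} (hlam : 0 ≤ lam)
    (Λl : L → ℝ) (hΛpos : ∀ k ∈ K, 0 < Λl k) (hΛl : ∀ k ∈ K, ∀ γ ∈ S k, ∑ i ∈ T, a i γ ≤ Λl k)
    (hΛsum : ∑ k ∈ K, Λl k ≤ Λ) (hW : ∀ i ∈ T, ∑ k ∈ K, ∑ γ ∈ S k, a i γ * w γ ≤ W)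
    (hPL : ∀ k ∈ K, ∀ A, A ⊆ S k → μ.real (⋂ γ ∈ A, E γ) ≤ ∏ γ ∈ A, w γ) :
    ∫ ω, Real.exp (lam * ∑ i ∈ T, ∑ k ∈ K, ∑ γ ∈ S k, a i γ * (E γ).indicator (fun _ => (1 : ℝ)) ω) ∂μ ≤
      Real.exp (lam * Real.exp (lam * Λ) * W * T.card) := by
  refine (integral_exp_mul_sum_levels_le μ T K S E hE w hw a ha hlam Λl hΛpos hΛl hΛsum hPL).trans
    (Real.exp_le_exp.2 ?_)
  calc lam * Real.exp (lam * Λ) * ∑ i ∈ T, ∑ k ∈ K, ∑ γ ∈ S k, a i γ * w γ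
      ≤ lam * Real.exp (lam * Λ) * ∑ _i ∈ T, W :=
        mul_le_mul_of_nonneg_left (Finset.sum_le_sum fun i hi => hW i hi) (mul_nonneg hlam (Real.exp_nonneg _))
    _ = lam * Real.exp (lam * Λ) * W * T.card := by
        rw [Finset.sum_const, nsmul_eq_mul]; ring

end Levelwise

end Summit.QuantumFields.YangMills.Cruxes.UVSeamRec.PolymerRarity

end
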